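import Literature.NumberTheory.Automorphic.CDTTheorem712
import Literature.NumberTheory.EllipticCurves.ModFiveCongruenceHesseFamily
import Literature.NumberTheory.EllipticCurves.GlobalMinimalModel
import Literature.NumberTheory.EllipticCurves.GlobalMinimalModelProofs
import Literature.NumberTheory.EllipticCurves.LeadingTermBSZOrdinaryProofs
import Literature.NumberTheory.EllipticCurves.CongruentNumberCurveJacobiSums
import Literature.NumberTheory.EllipticCurves.WeilPairingProofs
import Literature.NumberTheory.EllipticCurves.VariableChangePoints
import Literature.NumberTheory.EllipticCurves.TorsionFrobeniusChebotarevProofs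
import Literature.NumberTheory.EllipticCurves.SupersingularDensitySerreTraceProofs
import Literature.NumberTheory.EllipticCurves.ModPIrreducibleCongruenceTransferProofs
import Literature.NumberTheory.EllipticCurves.FrobeniusTateModuleTraceProofs
import Literature.NumberTheory.EllipticCurves.SemistableModPImageFiveProofs
import Literature.NumberTheory.GaloisRepresentations.QuarticTwistEulerFactors
import Literature.NumberTheory.GaloisRepresentations.AbsGaloisGroup
import Literature.NumberTheory.EllipticCurves.DivisionField
import Mathlib.NumberTheory.LSeries.PrimesInAP
import HarnessLib

/-!
# stub-ideation k1 (GEN 5, FAMILY 1 — recognise & import) for `stub_switch` = `CDT_three_five_switch`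

Companion of `STUB-IDEAS-stub_switch-1.md` (gen 5).  ONE uniform road, no image census, no second
anchor, no Deuring, no `ℚ̄`-level twist cocycles:

* **H1 (inertial switch element).**  For EVERY `E/ℚ`: an inertia element `τ₀` at `3` negating `√3`
  fixes `μ₂₀`, so `ρ̄_{E,5}(τ₀) ∈ SL₂(𝔽₅) = 2I` and `σ := τ₀¹⁵` acts on `μ₆₀` by `ζ ↦ ζ⁴¹`
  (`i ↦ i`, `ζ₃ ↦ ζ₃²`, `ζ₅ ↦ ζ₅`) while `ρ̄(σ) ∈ {1, −1} ∪ {g : g² = −1}` (F1, `decide`).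
* **H2 (Chebotarev, tree PROVED `exists_isArithFrobAt_mul_inv_mem_not_mem` + `smul_eq_pow_of_isArithFrobAt_rat`).**
  A prime `ℓ ≡ 41 (mod 60)` outside any finite set with `Frob_ℓ = σ` on `E[5]`.
* **H3–H5 (all over `𝔽_ℓ`).**  `g² = −1, det g = 1 ⇒ tr g = 0` (F1′, `decide`), so in the order-4 case
  `5 ∣ a_ℓ` (H3); the `j = 1728` anchor `y² = x³ + a x` over `𝔽_ℓ` (`ℓ ≡ 1 (20)`) realises trace `0`
  (H4a) and Frobenius `= ±1` on `5`-torsion (H4b) by Gauss's count (tree PROVED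
  `IrelandRosen1990_card_points_one_mod_four_holds`) and the `[i]`-eigenlines; H5a (= gen-4 B5,
  separable trace criterion) / H5b (scalar criterion) give a DIRECT `5`-congruence over `𝔽_ℓ`.
* **H6 (bridge, only in the scalar sub-case `ρ̄(σ) = ±1`).**  `Frob_𝔓 = ε` on `E♭[5]` ⇒ the
  `ℓ`-Frobenius is `ε` on `Ẽ♭[5]` (tree PROVED `exists_reduceTorsionHom` pattern, VII.3.1(b)).
* **H7 = Fisher 13.2 (ii) over `𝔽_ℓ`** (named fact shared with k1-g4 / k3) + (S) root extraction.

Output: `RootSupply c₄ c₆` — a prime `ℓ ≡ 5 (12)` outside any finite set and an `𝔽_ℓ`-root of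
Fisher's `𝔠₆(c₄,c₆;·,1)` off `𝔠₄ = 0` — which is EXACTLY what k3-g4's kernel-checked assembly
consumes after its `Core1728 → T3 → G3`; the tail (G2, Fisher (i), `tail` with N3 + F2) is k3-g4's,
restated here so that `stub_switch_of_rootSupply` is kernel-checked modulo the named helpers.
`lean check`: sorries ONLY in helper statements; F1, F1′, `rootSupply_of_anchorRoad` (the composition
H1–H7 ⇒ RootSupply) and `stub_switch_of_rootSupply` are kernel-checked.
-/

set_option linter.dupNamespace false

namespace Summit.ABC.ABC.Cruxes.FreyModularity.StubSwitchK1G5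

open Literature.NumberTheory.EllipticCurves Literature.NumberTheory.EllipticCurves.HesseFamilyFive
open Literature.NumberTheory.EllipticCurves.BSZLemma17
open Literature.NumberTheory.Automorphic Literature.NumberTheory.GaloisRepresentations
open Literature.NumberTheory.Automorphic.BCDT WeierstrassCurve Field NumberField IsDedekindDomain

noncomputable section

universe u

/-! ## §0 Objects (verbatim from k1-g4 / k3-g4; crux-dir modules are not importable) -/

/-- Fisher's base model `E : y² = x³ − 27c₄x − 54c₆` over a field. -/
abbrev baseF {F : Type u} [Field F] (c₄ c₆ : F) : WeierstrassCurve F := ⟨0, 0, 0, -27 * c₄, -54 * c₆⟩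

/-- The Hesse member `E_{l,m}` (tree polynomials `HesseFamilyFive.C4/C6`). -/
abbrev memberF {F : Type u} [Field F] (c₄ c₆ l m : F) : WeierstrassCurve F :=
  ⟨0, 0, 0, -27 * C4 c₄ c₆ l m, -54 * C6 c₄ c₆ l m⟩

/-- k3's `ℚ`-objects. -/
abbrev member (c₄ c₆ l m : ℚ) : WeierstrassCurve ℚ := ⟨0, 0, 0, -27 * C4 c₄ c₆ l m, -54 * C6 c₄ c₆ l m⟩
/-- k3's `c₄c₆`-model over `ℚ`. -/
abbrev base (c₄ c₆ : ℚ) : WeierstrassCurve ℚ := ⟨0, 0, 0, -27 * c₄, -54 * c₆⟩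

/-- `a = q + 1 − #V(𝔽_q)`. -/
def trace (q : ℕ) (V : WeierstrassCurve (ZMod q)) : ℤ := (q : ℤ) + 1 - Nat.card V.toAffine.Point

/-- Direct `5`-congruence over a field ([Fisher2012Hessian] Def. 13.1). -/
def DirectCongrFive {F : Type u} [Field F] (W₁ W₂ : WeierstrassCurve F) [W₁.IsElliptic] [W₂.IsElliptic]
    (h5 : ((5 : ℕ) : F) ≠ 0) : Prop :=
  ∃ e : W₁.geomTorsion 5 ≃+ W₂.geomTorsion 5,
    (∀ (σ : absoluteGaloisGroup F) (P : W₁.geomTorsion 5), e (σ • P) = σ • e P) ∧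
    ∀ P Q : W₁.geomTorsion 5,
      weilPairingFun h5 ((e P : W₂.geomTorsion 5) : W₂.geomPoints) ((e Q : W₂.geomTorsion 5) : W₂.geomPoints)
        = weilPairingFun h5 (P : W₁.geomPoints) (Q : W₁.geomPoints)

/-- N2′ (named fact, shared with k1-g4 / k3): Fisher 2012 Thm 13.2 (ii) over `𝔽_q`. [Fisher2012Hessian, Thm 13.2] -/
def Thm132iiPrimeField : Prop :=
  ∀ (q : ℕ) [Fact q.Prime], 7 ≤ q → ∀ (h5 : ((5 : ℕ) : ZMod q) ≠ 0)
    (E E' : WeierstrassCurve (ZMod q)) [E.IsElliptic] [E'.IsElliptic] (c₄ c₆ : ZMod q),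
    E = baseF c₄ c₆ → DirectCongrFive E E' h5 →
      ∃ (l m : ZMod q) (C : VariableChange (ZMod q)), C • E' = memberF c₄ c₆ l m

/-- F2 (k1 gen-2 atom, shared with k3): the order-8 Frobenius certificate at `3`. -/
def FrobeniusCertificate : Prop :=
  ∀ (W : WeierstrassCurve ℚ) [W.IsElliptic] [W.IsGloballyMinimal] (q : ℕ) [Fact q.Prime],
    q % 3 = 2 → W.HasGoodReductionAtPrime q → ¬ (3 : ℤ) ∣ W.frobeniusTrace q →
    ∀ ρ₃ : ModPGaloisRep ℚ (ZMod 3) 2, W.IsTorsionGaloisRep 3 ρ₃ → ρ₃.IsAbsIrreducibleOverSqrt (-3)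

/-- The `j = 1728` anchor over any ring: `y² = x³ + a x`. -/
abbrev anchor {R : Type} [CommRing R] (a : R) : WeierstrassCurve R := ⟨0, 0, 0, a, 0⟩

/-! ## §1 The interface (what k3-g4's kernel-checked assembly consumes after `Core1728 → T3 → G3`) -/

/-- **RootSupply.**  Outside any finite set of primes there is `ℓ ≡ 5 (mod 12)` and an `𝔽_ℓ`-root `t̄`
of Fisher's `𝔠₆(c₄, c₆; ·, 1)` with `𝔠₄(t̄, 1) ≠ 0` (so the member `E_t`, `t ≡ t̄`, reduces mod `ℓ` to a
`j = 1728` curve).  Exactly the output type of k3-g4's `exists_prime_five_mod_twelve_root`. -/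
def RootSupply (c₄ c₆ : ℤ) : Prop :=
  ∀ S : Finset ℕ, ∃ (ℓ : ℕ) (_ : Fact ℓ.Prime), ℓ ∉ S ∧ ℓ % 12 = 5 ∧
    ∃ t : ℤ, C6 (c₄ : ZMod ℓ) (c₆ : ZMod ℓ) (t : ZMod ℓ) 1 = 0 ∧
      C4 (c₄ : ZMod ℓ) (c₆ : ZMod ℓ) (t : ZMod ℓ) 1 ≠ 0

/-! ## §2 Finite certificates (kernel-checked) -/

/-- `2 × 2` matrices over `𝔽₅` as quadruples `(a, b, c, d)` (a `decide`-friendly carrier). -/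
def mul2 (x y : ZMod 5 × ZMod 5 × ZMod 5 × ZMod 5) : ZMod 5 × ZMod 5 × ZMod 5 × ZMod 5 :=
  (x.1 * y.1 + x.2.1 * y.2.2.1, x.1 * y.2.1 + x.2.1 * y.2.2.2,
    x.2.2.1 * y.1 + x.2.2.2 * y.2.2.1, x.2.2.1 * y.2.1 + x.2.2.2 * y.2.2.2)

/-- `x ^ (n+1)` on quadruples. -/
def pow2 (x : ZMod 5 × ZMod 5 × ZMod 5 × ZMod 5) : ℕ → ZMod 5 × ZMod 5 × ZMod 5 × ZMod 5
  | 0 => (1, 0, 0, 1)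
  | n + 1 => mul2 (pow2 x n) x

/-- **F1 (`decide`): in `SL₂(𝔽₅)` every fifteenth power is `1`, `−1` or of square `−1`** (element
orders `1,2,3,4,5,6,10`; = k3-g3's PROVED F1–F4), on the quadruple carrier `mul2/pow2`. -/
theorem pow_fifteen_trichotomy :
    ∀ a b c d : ZMod 5, a * d - b * c = 1 →
      pow2 (a, b, c, d) 15 = (1, 0, 0, 1) ∨ pow2 (a, b, c, d) 15 = (-1, 0, 0, -1) ∨
        mul2 (pow2 (a, b, c, d) 15) (pow2 (a, b, c, d) 15) = (-1, 0, 0, -1) := by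
  decide +kernel

/-- **F1′ (`decide`): `g² = −1`, `det g = 1` in `GL₂(𝔽₅)` forces `tr g = 0`** (Cayley–Hamilton). -/
theorem trace_zero_of_sq_eq_neg_one :
    ∀ a b c d : ZMod 5, a * d - b * c = 1 → mul2 (a, b, c, d) (a, b, c, d) = (-1, 0, 0, -1) →
      a + d = 0 := by
  decide +kernel

/-! ## §3 Helper lemmas (the road; each ≈ one prover cycle unless marked) -/

/-- **H1 (M) — the inertial switch element.**  For every elliptic `W/ℚ` there is `σ ∈ Γ_ℚ` acting on
`μ₆₀` by `ζ ↦ ζ⁴¹` (`i ↦ i`, `√−3 ↦ −√−3`, `ζ₅ ↦ ζ₅`) with `ρ̄_{W,5}(σ) ∈ {1, −1} ∪ {g : g² = −1}`.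
Proof: `s² = 3`, `τ₀ ∈ I_𝔔` (`𝔔 ∣ 3`) with `τ₀ s = −s` (PROVED `exists_mem_inertia_smul_eq_neg_of_sq_eq_prime`);
`τ₀` fixes `μ₂₀` (PROVED `smul_eq_self_of_mem_inertia_of_pow_eq_one_of_not_mem`), so `τ₀ ζ₆₀ = ζ₆₀⁴¹` and
`det ρ̄(τ₀) = χ₅(τ₀) = 1` (PROVED `det_eq_modPCyclotomicCharacter_of_isTorsionGaloisRep_holds`); put
`σ := τ₀¹⁵` (`41¹⁵ ≡ 41 (60)`) and read F1 in a frame (`nonempty_geomTorsion_addEquiv_fin_two`, `rhoMat`). -/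
theorem exists_inertialSwitchElement (W : WeierstrassCurve ℚ) [W.IsElliptic] :
    ∃ σ : absoluteGaloisGroup ℚ,
      (∀ ζ : AlgebraicClosure ℚ, ζ ^ 60 = 1 → σ • ζ = ζ ^ 41) ∧
      ((∀ P : W.geomTorsion 5, σ • P = P) ∨ (∀ P : W.geomTorsion 5, σ • P = -P) ∨
        (∀ P : W.geomTorsion 5, σ • (σ • P) = -P)) := by
  sorry

/-- **H2 (M) — Chebotarev with the cyclotomic side condition.**  For `σ` acting on `μ₆₀` by `41` there is,
outside any finite `S`, a prime `ℓ ≡ 41 (mod 60)` and an arithmetic Frobenius `φ` at some `𝔓 ∣ ℓ` with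
`φ = σ` on `W[5]`.  Proof: the tree's PROVED `exists_isArithFrobAt_mul_inv_mem_not_mem` for the open normal
subgroup `N = ker(Γ_ℚ → Aut W[5]) ⊓ Gal(ℚ̄/ℚ(μ₆₀))` (as in PROVED `chebotarev_geomTorsion_holds`), then
`φσ⁻¹ ∈ N`, and PROVED `smul_eq_pow_of_isArithFrobAt_rat`: `φ ζ₆₀ = ζ₆₀^ℓ`, so `ℓ ≡ 41 (60)` once `2,3,5 ∈ S`. -/
theorem switchPrime_supply (W : WeierstrassCurve ℚ) [W.IsElliptic] (σ : absoluteGaloisGroup ℚ)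
    (hσ : ∀ ζ : AlgebraicClosure ℚ, ζ ^ 60 = 1 → σ • ζ = ζ ^ 41) (S : Set ℕ) (hS : S.Finite) :
    ∃ (ℓ : ℕ) (v : HeightOneSpectrum (𝓞 ℚ)) (𝔓 : Ideal (absIntegers (𝓞 ℚ) ℚ))
      (φ : absoluteGaloisGroup ℚ),
      ℓ.Prime ∧ ℓ ∉ S ∧ ℓ % 60 = 41 ∧ (ℓ : 𝓞 ℚ) ∈ v.asIdeal ∧ 𝔓 ∈ v.primesAbove ∧
        IsArithFrobAt (𝓞 ℚ) φ 𝔓 ∧ ∀ P : W.geomTorsion 5, φ • P = σ • P := by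
  sorry

/-- **H3 (S/M) — order-4 case ⇒ `5 ∣ a_ℓ` of the integral `c₄c₆`-model.**  `φ² = −1` on `E♭[5]` with
`ℓ ≡ 1 (5)`: transport to a global minimal model `C • E♭` (PROVED `hasGlobalMinimalModel_rat_holds`,
`Congr`/`VariableChangePoints`), `tr ρ̄(φ) = a_ℓ`, `det = ℓ = 1` (PROVED `trace/det_galoisRepTorsion_frobenius_eq`),
F1′, and PROVED `frobeniusTrace_eq_of_smul_eq_shortWeierstrass` (`a_ℓ = ℓ + 1 − #Ẽ♭(𝔽_ℓ)`, `ℓ ∤ 6Δ`). -/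
theorem trace_baseF_zero_of_sq_eq_neg (c₄ c₆ : ℤ) [(base (c₄ : ℚ) c₆).IsElliptic]
    {ℓ : ℕ} [Fact ℓ.Prime] (hℓ : ¬ (ℓ : ℤ) ∣ 30 * (c₄ ^ 3 - c₆ ^ 2)) (hℓ5 : ℓ % 5 = 1)
    {v : HeightOneSpectrum (𝓞 ℚ)} (hℓv : (ℓ : 𝓞 ℚ) ∈ v.asIdeal)
    {𝔓 : Ideal (absIntegers (𝓞 ℚ) ℚ)} (h𝔓 : 𝔓 ∈ v.primesAbove)
    {φ : absoluteGaloisGroup ℚ} (hφ : IsArithFrobAt (𝓞 ℚ) φ 𝔓)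
    (hsq : ∀ P : (base (c₄ : ℚ) c₆).geomTorsion 5, φ • (φ • P) = -P) :
    (trace ℓ (baseF (c₄ : ZMod ℓ) (c₆ : ZMod ℓ)) : ZMod 5) = 0 := by
  sorry

/-- **H4a (S/M) — the anchor with trace `≡ 0 (mod 5)`.**  `ℓ ≡ 1 (20)`: `ℓ = a′² + b′²` forces
`5 ∣ a′b′`, and the four quartic twists of `y² = x³ + x` have `a_ℓ ∈ {±2a′, ±2b′}` (Gauss; PROVED
`IrelandRosen1990_card_points_one_mod_four_holds`, cf. k3-g4 N3's proof). (= k1-g4 B3 at `x + y = 0`.) -/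
theorem anchor_trace_zero (ℓ : ℕ) [Fact ℓ.Prime] (hℓ : ℓ % 20 = 1) :
    ∃ (a : ZMod ℓ) (_ : (anchor a).IsElliptic), a ≠ 0 ∧ (trace ℓ (anchor a) : ZMod 5) = 0 := by
  sorry

/-- **H4b (M) — the anchor with SCALAR Frobenius `ε = ±1` on `5`-torsion.**  `ℓ ≡ 1 (20)`: a twist with
`a_ℓ ≡ 2ε (mod 5)` exists (Gauss, as in H4a), and its Frobenius is semisimple on `E[5]` because it commutes
with the `𝔽_ℓ`-rational automorphism `[i] : (x,y) ↦ (−x, ιy)` (`ι² = −1`), whose eigenlines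
`E[2 − i], E[2 + i]` split `E[5]`; `x + y = 2ε`, `xy = 1` force `x = y = ε`. (ε = 1: full rational
`5`-torsion, `π ≡ 1 (mod 5ℤ[i])`.) -/
theorem anchor_frob_scalar (ℓ : ℕ) [Fact ℓ.Prime] (hℓ : ℓ % 20 = 1) (ε : ℤ) (hε : ε = 1 ∨ ε = -1)
    {frob : absoluteGaloisGroup (ZMod ℓ)} (hfrob : ∀ x : AlgebraicClosure (ZMod ℓ), frob • x = x ^ ℓ) :
    ∃ (a : ZMod ℓ) (_ : (anchor a).IsElliptic), a ≠ 0 ∧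
      ∀ P : (anchor a).geomTorsion 5, frob • P = ε • P := by
  sorry

/-- **H5a (M, = k1-g4 B5) — separable trace criterion for a direct `5`-congruence over `𝔽_ℓ`.**
PROVED inputs: `trace_galoisRepTate_frobenius_holds`, `det_galoisRepTate_frobenius_holds`,
`galoisRepTate_frobenius_sq_sub_smul_add_smul_eq_zero`, `exists/unique` Frobenius of `Γ_{𝔽_ℓ}`. -/
theorem directCongrFive_of_trace_eq_of_separable (ℓ : ℕ) [Fact ℓ.Prime]
    (h5 : ((5 : ℕ) : ZMod ℓ) ≠ 0) (V V' : WeierstrassCurve (ZMod ℓ)) [V.IsElliptic] [V'.IsElliptic]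
    (htr : (trace ℓ V : ZMod 5) = (trace ℓ V' : ZMod 5))
    (hsep : (trace ℓ V : ZMod 5) ^ 2 - 4 * (ℓ : ZMod 5) ≠ 0) : DirectCongrFive V V' h5 := by
  sorry

/-- **H5b (S/M) — scalar criterion.**  If the `ℓ`-Frobenius is the same scalar `ε` on `V[5]` and `V'[5]`,
then `V, V'` are directly `5`-congruent: every `τ ∈ Γ_{𝔽_ℓ}` acts on both as `ε^{n(τ)}` (image of `Γ_{𝔽_ℓ}`
topologically generated by `frob`), so ANY additive isomorphism is equivariant; choose it symplectic
(`e₅` onto `μ₅` on both sides, PROVED Weil pairing facts `exists_weilPairing_holds` / `weilPairingFun_*`). -/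
theorem directCongrFive_of_scalar (ℓ : ℕ) [Fact ℓ.Prime] (h5 : ((5 : ℕ) : ZMod ℓ) ≠ 0)
    (V V' : WeierstrassCurve (ZMod ℓ)) [V.IsElliptic] [V'.IsElliptic]
    {frob : absoluteGaloisGroup (ZMod ℓ)} (hfrob : ∀ x : AlgebraicClosure (ZMod ℓ), frob • x = x ^ ℓ)
    (ε : ℤ) (hV : ∀ P : V.geomTorsion 5, frob • P = ε • P)
    (hV' : ∀ P : V'.geomTorsion 5, frob • P = ε • P) : DirectCongrFive V V' h5 := by
  sorry

/-- **H6 (L−, ONLY consumed in the scalar sub-case) — the reduction bridge.**  `φ` an arithmetic Frobenius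
at `𝔓 ∣ ℓ`, `ℓ ∤ 30(c₄³ − c₆²)`: if `φ = ε` on `E♭[5]` (`E♭ = base c₄ c₆`), then the `ℓ`-power Frobenius is
`ε` on `Ẽ♭[5]`, `Ẽ♭ = baseF c̄₄ c̄₆` over `𝔽_ℓ`.  Pieces (all tree, PROVED): (a) `exists_reduceTorsionHom`
(VII.3.1(b): injective Frobenius-equivariant `E[5^∞] → Ẽ_v(k̄_v)`, image `= Ẽ_v[5]` by counting,
`natCard_geomTorsion` + III.6.4(b) as in `TorsionFrobeniusProofs`), global-vs-local Frobenius as in `galoisRepTate_frobenius_conj_reductionAt_holds`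
(inertia acts trivially on `E[5]`, `smul_eq_self_of_mem_inertia…`); (b) `W.reductionAt v ≅ E♭ mod ℓ` over
`k_v` (both reductions of `v`-integral models with unit `Δ`; `exists_variableChange_eq_localMinimalIntegralModel`,
`VariableChangePoints`); (c) transport `k_v ≃ ZMod ℓ`, `k̄_v ≃ \overline{𝔽_ℓ}` (`adicCompletionIntegers.padicIntEquiv`,
`PadicInt.residueField`, `integralModel_eq_of_baseChange_eq` as in PROVED `lFunction_map_apply_prime_of_not_dvd`;
`IsAlgClosure.equivOfEquiv`, `frobenius_absoluteGaloisGroup_unique`). -/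
theorem frob_reduction_of_scalar (c₄ c₆ : ℤ) [(base (c₄ : ℚ) c₆).IsElliptic]
    {ℓ : ℕ} [Fact ℓ.Prime] (hℓ : ¬ (ℓ : ℤ) ∣ 30 * (c₄ ^ 3 - c₆ ^ 2))
    [(baseF (c₄ : ZMod ℓ) (c₆ : ZMod ℓ)).IsElliptic]
    {v : HeightOneSpectrum (𝓞 ℚ)} (hℓv : (ℓ : 𝓞 ℚ) ∈ v.asIdeal)
    {𝔓 : Ideal (absIntegers (𝓞 ℚ) ℚ)} (h𝔓 : 𝔓 ∈ v.primesAbove)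
    {φ : absoluteGaloisGroup ℚ} (hφ : IsArithFrobAt (𝓞 ℚ) φ 𝔓)
    {frob : absoluteGaloisGroup (ZMod ℓ)} (hfrob : ∀ x : AlgebraicClosure (ZMod ℓ), frob • x = x ^ ℓ)
    (ε : ℤ) (hW : ∀ P : (base (c₄ : ℚ) c₆).geomTorsion 5, φ • P = ε • P) :
    ∀ Q : (baseF (c₄ : ZMod ℓ) (c₆ : ZMod ℓ)).geomTorsion 5, frob • Q = ε • Q := by
  sorry

/-- **H7′ (S) — root extraction from membership of a `j = 1728` curve.**  `C • (y² = x³ + a x) = E_{l,m}`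
over `𝔽_ℓ` (`ℓ ≥ 7`, `a ≠ 0`, `c̄₆ ≠ 0`): `c₆ = 0` is an isomorphism invariant up to `u⁻⁶`, so
`𝔠₆(l,m) = 0`, `𝔠₄(l,m) ≠ 0`; `m ≠ 0` (else `𝔠₆(l,0) = c̄₆ l³⁰`, tree `C6_one_zero`, and `l = 0` would make
`E_{0,0}` singular); `t := l/m` by homogeneity (degrees `20`, `30`). -/
theorem root_of_member_anchor (ℓ : ℕ) [Fact ℓ.Prime] (hℓ7 : 7 ≤ ℓ) (c₄ c₆ l m a : ZMod ℓ)
    (hc₆ : c₆ ≠ 0) (ha : a ≠ 0) (C : VariableChange (ZMod ℓ)) (h : C • anchor a = memberF c₄ c₆ l m) :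
    ∃ t : ZMod ℓ, C6 c₄ c₆ t 1 = 0 ∧ C4 c₄ c₆ t 1 ≠ 0 := by
  sorry

/-- XS: the `c₄c₆`-model is elliptic (`Δ = 2⁶3⁹(c₄³ − c₆²)`). -/
theorem isElliptic_base (c₄ c₆ : ℤ) (hc : c₄ ^ 3 ≠ c₆ ^ 2) : (base (c₄ : ℚ) c₆).IsElliptic := by
  sorry

/-- XS: its reduction at `ℓ ∤ 30(c₄³ − c₆²)` is elliptic. -/
theorem isElliptic_baseF (ℓ : ℕ) [Fact ℓ.Prime] (c₄ c₆ : ℤ) (hℓ : ¬ (ℓ : ℤ) ∣ 30 * (c₄ ^ 3 - c₆ ^ 2)) :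
    (baseF (c₄ : ZMod ℓ) (c₆ : ZMod ℓ)).IsElliptic := by
  sorry

/-- PROVED (k1-g3): a nonzero integer of absolute value below `q` is not divisible by `q`. -/
theorem not_dvd_of_natAbs_lt {q : ℕ} {z : ℤ} (hz : z ≠ 0) (hlt : z.natAbs < q) : ¬ (q : ℤ) ∣ z := by
  intro h
  have h1 : q ∣ z.natAbs := by
    rcases h with ⟨k, hk⟩
    exact ⟨k.natAbs, by rw [hk, Int.natAbs_mul, Int.natAbs_natCast]⟩
  exact absurd (Nat.le_of_dvd (Int.natAbs_pos.mpr hz) h1) (not_le.mpr hlt)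

/-! ## §4 The CORE, kernel-checked: H1–H7 ⇒ `RootSupply` -/

/-- **The core (PROVED from H1–H7′ + the named fact).**  `S ↦ S ∪ [0, |30c₆(c₄³−c₆²)|]`; H1 on `E♭`;
H2; trichotomy: order `4` ⇒ H3 + H4a + H5a (`0² − 4·1 ≠ 0 in 𝔽₅`); scalar `ε` ⇒ H6 + H4b + H5b;
then Fisher (ii) over `𝔽_ℓ` and H7′. -/
theorem rootSupply_of_anchorRoad (hFii : Thm132iiPrimeField) (c₄ c₆ : ℤ) (hc : c₄ ^ 3 ≠ c₆ ^ 2)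
    (hc₆ : c₆ ≠ 0) : RootSupply c₄ c₆ := by
  intro S
  haveI hE : (base (c₄ : ℚ) c₆).IsElliptic := isElliptic_base c₄ c₆ hc
  -- the bad integer and the enlarged finite set
  set z : ℤ := 30 * c₆ * (c₄ ^ 3 - c₆ ^ 2) with hz
  have hz0 : z ≠ 0 := mul_ne_zero (mul_ne_zero (by norm_num) hc₆) (sub_ne_zero.mpr hc)
  set S' : Finset ℕ := S ∪ Finset.range (z.natAbs + 1) with hS'
  -- H1, H2
  obtain ⟨σ, hσζ, hσ⟩ := exists_inertialSwitchElement (base (c₄ : ℚ) c₆)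
  obtain ⟨ℓ, v, 𝔓, φ, hℓp, hℓS', h60, hℓv, h𝔓, hφ, hact⟩ :=
    switchPrime_supply (base (c₄ : ℚ) c₆) σ hσζ (↑S') S'.finite_toSet
  haveI : Fact ℓ.Prime := ⟨hℓp⟩
  have hℓS : ℓ ∉ S := fun h => hℓS' (Finset.mem_coe.mpr (Finset.mem_union_left _ h))
  have hℓgt : z.natAbs < ℓ := by
    by_contra hle
    exact hℓS' (Finset.mem_coe.mpr (Finset.mem_union_right _ (Finset.mem_range.mpr (by omega))))
  have hℓz : ¬ (ℓ : ℤ) ∣ z := not_dvd_of_natAbs_lt hz0 hℓgt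
  have hℓ30 : ¬ (ℓ : ℤ) ∣ 30 * (c₄ ^ 3 - c₆ ^ 2) := fun h => hℓz (by
    rw [hz, show (30 : ℤ) * c₆ * (c₄ ^ 3 - c₆ ^ 2) = c₆ * (30 * (c₄ ^ 3 - c₆ ^ 2)) by ring]
    exact dvd_mul_of_dvd_right h _)
  have hℓc₆ : ¬ (ℓ : ℤ) ∣ c₆ := fun h => hℓz (by
    rw [hz, show (30 : ℤ) * c₆ * (c₄ ^ 3 - c₆ ^ 2) = c₆ * (30 * (c₄ ^ 3 - c₆ ^ 2)) by ring]
    exact dvd_mul_of_dvd_left h _)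
  have h7 : 7 ≤ ℓ := by omega
  have h12 : ℓ % 12 = 5 := by omega
  have h20 : ℓ % 20 = 1 := by omega
  have hℓ5 : ℓ % 5 = 1 := by omega
  have h5 : ((5 : ℕ) : ZMod ℓ) ≠ 0 := by
    rw [Ne, ZMod.natCast_eq_zero_iff]
    intro h
    have := (Nat.prime_dvd_prime_iff_eq hℓp (by norm_num)).mp h
    omega
  have hc₆' : (c₆ : ZMod ℓ) ≠ 0 := by rwa [Ne, ZMod.intCast_zmod_eq_zero_iff_dvd]
  haveI hV : (baseF (c₄ : ZMod ℓ) (c₆ : ZMod ℓ)).IsElliptic := isElliptic_baseF ℓ c₄ c₆ hℓ30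
  obtain ⟨frob, hfrob0⟩ := exists_frobenius_absoluteGaloisGroup (ZMod ℓ)
  have hfrob : ∀ x : AlgebraicClosure (ZMod ℓ), frob • x = x ^ ℓ := fun x => by
    rw [hfrob0 x, Nat.card_zmod]
  -- the anchor, directly 5-congruent to `Ẽ♭`, in each of the three cases
  have hanchor : ∃ (a : ZMod ℓ) (_ : (anchor a).IsElliptic), a ≠ 0 ∧
      DirectCongrFive (baseF (c₄ : ZMod ℓ) (c₆ : ZMod ℓ)) (anchor a) h5 := by
    rcases hσ with hσ | hσ | hσ
    · -- scalar `+1`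
      have hW : ∀ P : (base (c₄ : ℚ) c₆).geomTorsion 5, φ • P = (1 : ℤ) • P := fun P => by
        rw [hact P, hσ P, one_zsmul]
      have hred := frob_reduction_of_scalar c₄ c₆ hℓ30 hℓv h𝔓 hφ hfrob 1 hW
      obtain ⟨a, hael, ha, hV'⟩ := anchor_frob_scalar ℓ h20 1 (Or.inl rfl) hfrob
      exact ⟨a, hael, ha, directCongrFive_of_scalar ℓ h5 _ _ hfrob 1 hred hV'⟩
    · -- scalar `−1`
      have hW : ∀ P : (base (c₄ : ℚ) c₆).geomTorsion 5, φ • P = (-1 : ℤ) • P := fun P => by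
        rw [hact P, hσ P, neg_one_zsmul]
      have hred := frob_reduction_of_scalar c₄ c₆ hℓ30 hℓv h𝔓 hφ hfrob (-1) hW
      obtain ⟨a, hael, ha, hV'⟩ := anchor_frob_scalar ℓ h20 (-1) (Or.inr rfl) hfrob
      exact ⟨a, hael, ha, directCongrFive_of_scalar ℓ h5 _ _ hfrob (-1) hred hV'⟩
    · -- order `4`: trace level
      have hsq : ∀ P : (base (c₄ : ℚ) c₆).geomTorsion 5, φ • (φ • P) = -P := fun P => by
        rw [hact P, hact (σ • P)]; exact hσ P
      have htr := trace_baseF_zero_of_sq_eq_neg c₄ c₆ hℓ30 hℓ5 hℓv h𝔓 hφ hsq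
      obtain ⟨a, hael, ha, htr'⟩ := anchor_trace_zero ℓ h20
      have hℓ' : (ℓ : ZMod 5) = 1 := by
        rw [← ZMod.natCast_mod, hℓ5]; rfl
      refine ⟨a, hael, ha, directCongrFive_of_trace_eq_of_separable ℓ h5 _ _ (htr.trans htr'.symm) ?_⟩
      rw [htr, hℓ']; decide
  obtain ⟨a, hael, ha, hcongr⟩ := hanchor
  haveI := hael
  obtain ⟨l, m, C, hC⟩ := hFii ℓ h7 h5 (baseF (c₄ : ZMod ℓ) (c₆ : ZMod ℓ)) (anchor a)
    (c₄ : ZMod ℓ) (c₆ : ZMod ℓ) rfl hcongr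
  obtain ⟨t, ht6, ht4⟩ := root_of_member_anchor ℓ h7 _ _ l m a hc₆' ha C hC
  refine ⟨ℓ, ⟨hℓp⟩, hℓS, h12, (t.val : ℤ), ?_, ?_⟩
  · simpa [ZMod.natCast_zmod_val] using ht6
  · simpa [ZMod.natCast_zmod_val] using ht4

/-! ## §5 RESHAPE VARIANT (γ) for the critic / lead: under `ρ̄_{W,5}` ONTO, Case "order 4" always holds
(so H4b, H5b, H6 are never consumed).  At the ONLY call site (`16 ∣ B`, semistable Frey curve) the tree
PROVES surjectivity: `hasSurjectiveModNGaloisRep_of_hasIrreducibleModPGaloisRep_of_isSemistable`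
(Serre 1972 Prop. 21 i / Edixhoven 1997 Prop. 2.1, `SemistableModPImageFiveProofs`, PROVED). -/

/-- **H1♯ (S/M) — split switch element under surjectivity.**  `H₆₀ := ρ̄(Γ_{ℚ(μ₆₀)}) ⊇ [GL₂(𝔽₅), GL₂(𝔽₅)] = SL₂(𝔽₅)`
(abelian quotient), so the coset of elements acting by `41` on `μ₆₀` meets the order-`4` class. -/
theorem exists_splitSwitchElement_of_surjective (W : WeierstrassCurve ℚ) [W.IsElliptic]
    (hs : W.HasSurjectiveModNGaloisRep ((5 : ℕ) : ℤ)) :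
    ∃ σ : absoluteGaloisGroup ℚ, (∀ ζ : AlgebraicClosure ℚ, ζ ^ 60 = 1 → σ • ζ = ζ ^ 41) ∧
      ∀ P : W.geomTorsion 5, σ • (σ • P) = -P := by
  sorry

/-! ## §6 The TAIL and the ASSEMBLY (k3-g4, restated; `tail` is PROVED there from N3 + tree, F2 as hypothesis) -/

/-- PROVED (gen 1): transport of a framed `5`-torsion model along a `5`-congruence. -/
theorem isTorsionGaloisRep_of_congr {W W' : WeierstrassCurve ℚ} (h : Congr W' W)
    {ρ : ModPGaloisRep ℚ (ZMod 5) 2} (hρ : W.IsTorsionGaloisRep 5 ρ) :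
    W'.IsTorsionGaloisRep 5 ρ := by
  obtain ⟨e', he'⟩ := h
  obtain ⟨e, he⟩ := hρ
  refine ⟨e'.trans e, fun σ P => ?_⟩
  rw [AddEquiv.trans_apply, AddEquiv.trans_apply, he', he]

/-- G2 (S, k3-g4 verbatim): the member has an integral short model read off `𝔠₄, 𝔠₆ (mod ℓ)`. -/
theorem member_integral_short_mod (ℓ : ℕ) [Fact ℓ.Prime] (hℓ : ℓ ∉ ({2, 3, 5, 11} : Finset ℕ))
    (c₄ c₆ t : ℤ) :
    ∃ (A B : ℤ) (Cv : VariableChange ℚ),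
      Cv • member c₄ c₆ t 1 = shortWeierstrass (A, B) ∧
      ((A : ZMod ℓ) = 0 ↔ C4 (c₄ : ZMod ℓ) (c₆ : ZMod ℓ) (t : ZMod ℓ) 1 = 0) ∧
      ((B : ZMod ℓ) = 0 ↔ C6 (c₄ : ZMod ℓ) (c₆ : ZMod ℓ) (t : ZMod ℓ) 1 = 0) := by
  sorry

/-- G6a (XS, k3 verbatim): an integral rescaling of `(c₄, c₆)`. -/
theorem exists_integral_scaling (x y : ℚ) :
    ∃ (u : ℤ) (c₄ c₆ : ℤ), u ≠ 0 ∧ (c₄ : ℚ) = (u : ℚ) ^ 4 * x ∧ (c₆ : ℚ) = (u : ℚ) ^ 6 * y := by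
  sorry

/-- G6b (XS, k3 verbatim): the rescaled `c₄c₆`-model is isomorphic to `W`. -/
theorem base_scaled (W : WeierstrassCurve ℚ) [W.IsElliptic] {u c₄ c₆ : ℤ} (hu : u ≠ 0)
    (h4 : (c₄ : ℚ) = (u : ℚ) ^ 4 * W.c₄) (h6 : (c₆ : ℚ) = (u : ℚ) ^ 6 * W.c₆) :
    ∃ Cv : VariableChange ℚ, Cv • W = base c₄ c₆ := by
  sorry

/-- G6c (PROVED, Dirichlet). -/
theorem exists_prime_five_mod_twelve_gt (n : ℕ) : ∃ ℓ : ℕ, ℓ.Prime ∧ n < ℓ ∧ ℓ % 12 = 5 := by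
  have h5 : IsUnit ((5 : ℕ) : ZMod 12) := by decide
  obtain ⟨ℓ, hgt, hp, hmod⟩ := Nat.forall_exists_prime_gt_and_eq_mod h5 n
  refine ⟨ℓ, hp, hgt, ?_⟩
  have := (ZMod.natCast_eq_natCast_iff' ℓ 5 12).1 hmod
  simpa using this

/-- **`tail` (k3-g4 §4, PROVED THERE, kernel-checked; restated as a helper here).** -/
theorem tail (hF2 : FrobeniusCertificate) (W : WeierstrassCurve ℚ) [W.IsElliptic] (A B : ℤ)
    [(shortWeierstrass (A, B)).IsElliptic] (hEW : Congr (shortWeierstrass (A, B)) W)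
    (ℓ : ℕ) [Fact ℓ.Prime] (h12 : ℓ % 12 = 5) (hA : ¬ (ℓ : ℤ) ∣ A) (hB : (ℓ : ℤ) ∣ B)
    (ρ : ModPGaloisRep ℚ (ZMod 5) 2) (hρ : W.IsTorsionGaloisRep 5 ρ) :
    ∃ (W' : WeierstrassCurve ℚ) (_ : W'.IsElliptic), W'.IsTorsionGaloisRep 5 ρ ∧
      ∃ ρ₃' : ModPGaloisRep ℚ (ZMod 3) 2, W'.IsTorsionGaloisRep 3 ρ₃' ∧
        ρ₃'.IsAbsIrreducibleOverSqrt (-3) := by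
  sorry

/-- **The line (generation 5), kernel-checked modulo the helpers: Fisher (i) + RootSupply + F2 ⇒ the stub.**
(= k3-g4's `stub_switch_of_core_and_tail` with `hCore + T3 + G3` replaced by `RootSupply`; none of the
stub's three standing hypotheses is used.) -/
theorem stub_switch_of_rootSupply (hF : thm132_geomTorsionFive_of_hesseFamily)
    (hRoot : ∀ c₄ c₆ : ℤ, c₄ ^ 3 ≠ c₆ ^ 2 → c₆ ≠ 0 → RootSupply c₄ c₆)
    (hF2 : FrobeniusCertificate) : CDT_three_five_switch := by
  intro W _ _ _ ρ hρ _
  obtain ⟨u, c₄, c₆, hu, h4, h6⟩ := exists_integral_scaling W.c₄ W.c₆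
  obtain ⟨Cv, hCv⟩ := base_scaled W hu h4 h6
  haveI hBell : (base (c₄ : ℚ) c₆).IsElliptic := by rw [← hCv]; infer_instance
  have hcongrB : Congr (base (c₄ : ℚ) c₆) W := congr_symm (congr_of_smul_eq Cv hCv)
  have hcQ : (c₄ : ℚ) ^ 3 ≠ (c₆ : ℚ) ^ 2 := by
    intro h
    have h1728 : (1728 : ℚ) * (base (c₄ : ℚ) c₆).Δ =
        (base (c₄ : ℚ) c₆).c₄ ^ 3 - (base (c₄ : ℚ) c₆).c₆ ^ 2 := (base (c₄ : ℚ) c₆).c_relation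
    have hc4 : (base (c₄ : ℚ) c₆).c₄ = 6 ^ 4 * c₄ := by
      simp only [WeierstrassCurve.c₄, WeierstrassCurve.b₂, WeierstrassCurve.b₄]; ring
    have hc6 : (base (c₄ : ℚ) c₆).c₆ = 6 ^ 6 * c₆ := by
      simp only [WeierstrassCurve.c₆, WeierstrassCurve.b₂, WeierstrassCurve.b₄, WeierstrassCurve.b₆]; ring
    rw [hc4, hc6, mul_pow, mul_pow, h, show ((6 : ℚ) ^ 4) ^ 3 = (6 ^ 6) ^ 2 by norm_num, ← sub_mul,
      sub_self, zero_mul] at h1728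
    exact (base (c₄ : ℚ) c₆).isUnit_Δ.ne_zero (by simpa using h1728)
  have hc : c₄ ^ 3 ≠ c₆ ^ 2 := fun h => hcQ (by exact_mod_cast h)
  by_cases hc₆ : c₆ = 0
  · -- `j(W) = 1728`: `W♭ = E_{−27c₄, 0}` itself
    subst hc₆
    have hc₄ : c₄ ≠ 0 := by rintro rfl; exact hc (by norm_num)
    have hz : (-27 * c₄ : ℤ) ≠ 0 := by omega
    obtain ⟨ℓ, hℓ, hgt, h12⟩ := exists_prime_five_mod_twelve_gt (-27 * c₄).natAbs
    haveI : Fact ℓ.Prime := ⟨hℓ⟩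
    have hbase : base (c₄ : ℚ) ((0 : ℤ) : ℚ) = shortWeierstrass (-27 * c₄, 0) := by
      ext <;> simp [shortWeierstrass]
    haveI : (shortWeierstrass (-27 * c₄, 0)).IsElliptic := by rw [← hbase]; exact hBell
    have hcongrE : Congr (shortWeierstrass (-27 * c₄, 0)) W := by rw [← hbase]; exact hcongrB
    exact tail hF2 W (-27 * c₄) 0 hcongrE ℓ h12 (not_dvd_of_natAbs_lt hz hgt) (dvd_zero _) ρ hρ
  · -- generic case: RootSupply at a prime `ℓ ≡ 5 (12)` outside `{2,3,5,11}`
    obtain ⟨ℓ, hℓF, hℓS, h12, t, ht6', ht4'⟩ := hRoot c₄ c₆ hc hc₆ {2, 3, 5, 11}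
    haveI := hℓF
    obtain ⟨A, B, Cv', hCv', hA4, hB6⟩ := member_integral_short_mod ℓ hℓS c₄ c₆ t
    have hA : ¬ (ℓ : ℤ) ∣ A := by
      rw [← ZMod.intCast_zmod_eq_zero_iff_dvd, hA4]; exact ht4'
    have hB : (ℓ : ℤ) ∣ B := by
      rw [← ZMod.intCast_zmod_eq_zero_iff_dvd, hB6]; exact ht6'
    have hℓ1 : ℓ % 4 = 1 := by omega
    have h2 : (2 : ZMod ℓ) ≠ 0 := GaussianQuartic.two_ne_zero_of_one_mod_four hℓ1
    have hA' : (A : ZMod ℓ) ≠ 0 := by rwa [Ne, ZMod.intCast_zmod_eq_zero_iff_dvd]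
    have hB' : (B : ZMod ℓ) = 0 := by rwa [ZMod.intCast_zmod_eq_zero_iff_dvd]
    have hne : 4 * (A, B).1 ^ 3 + 27 * (A, B).2 ^ 2 ≠ 0 := by
      intro h0
      have h0' := congrArg (Int.cast : ℤ → ZMod ℓ) h0
      push_cast at h0'
      rw [hB'] at h0'
      have : (4 : ZMod ℓ) * (A : ZMod ℓ) ^ 3 + 27 * (0 : ZMod ℓ) ^ 2 = 2 ^ 2 * (A : ZMod ℓ) ^ 3 := by ring
      rw [this] at h0'
      exact mul_ne_zero (pow_ne_zero _ h2) (pow_ne_zero _ hA') h0'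
    haveI hEell : (shortWeierstrass (A, B)).IsElliptic := isElliptic_of_ne_zero hne
    set E' : WeierstrassCurve ℚ := member c₄ c₆ t 1 with hE'
    haveI hE'ell : E'.IsElliptic := by
      have : E' = Cv'⁻¹ • shortWeierstrass (A, B) := by rw [← hCv', inv_smul_smul]
      rw [this]; infer_instance
    obtain ⟨e, he⟩ := hF (base (c₄ : ℚ) c₆) E' (c₄ : ℚ) (c₆ : ℚ) (t : ℚ) 1 rfl rfl
    have hcongrE : Congr (shortWeierstrass (A, B)) W :=
      congr_trans (congr_symm (congr_of_smul_eq Cv' hCv')) (congr_trans ⟨e, he⟩ hcongrB)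
    exact tail hF2 W A B hcongrE ℓ h12 hA hB ρ hρ

/-- **The whole road in one line: Fisher (i) + Fisher (ii)/𝔽_ℓ + F2 (+ H1–H7′) ⇒ `stub_switch`.** -/
theorem stub_switch_of_anchorRoad (hF : thm132_geomTorsionFive_of_hesseFamily)
    (hFii : Thm132iiPrimeField) (hF2 : FrobeniusCertificate) : CDT_three_five_switch :=
  stub_switch_of_rootSupply hF (fun c₄ c₆ hc hc₆ => rootSupply_of_anchorRoad hFii c₄ c₆ hc hc₆) hF2

end

end Summit.ABC.ABC.Cruxes.FreyModularity.StubSwitchK1G5
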